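import Summits.QuantumFields.BalabanUV.T4Continuum.Support.NE7CoarseCurlEnergyCurved
import Literature.MathematicalPhysics.QuantumFieldTheory.Balaban1983to89.B7Eq47AveragedBondVsStraight
import Literature.MathematicalPhysics.QuantumFieldTheory.Balaban1983to89.B9Eq315QLipschitz
import HarnessLib

/-!
# NE7CurvedPushDefectLetter — THE ONE-STEP LINEARISED AVERAGE AT A SMALL-FIELD BACKGROUND VERSUS THE FLAT ONE, IN `ℓ²` OVER THE PERIOD BOX:
# **`dirSq (cpush L W Y − cpush L 1 Y) [0,N)^d ≤ d²(2R+1)^{2d}·((κ_a·a + κ_b·b)·Q)²·dirSq Y [0,LN)^d`** (`R = (2d+2)L`, `Q = R + L`), LINEAR in the plaquette radius `a` AND in the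
# BONDWISE radius `b = sup‖W(x,μ) − 1‖` — the defect the curved exact lift corrects (memo SCOPING-R4 §3); it is NOT `O(a)` alone (§1: constant commuting flat data)
# (lineage `b2b-balaban-t4-ne7b-p1`, gen 163; route (H′), memo `t4/b2b-balaban-t4-ne7b-p1/g163/records/SCOPING-R4.md` §1–§3, file (R4b))

Cell `pub-balaban`, rung (B)+1 sub-cell t4, lineage `b2b-balaban-t4-ne7b-p1` (row NE7b OWNER + CRUX PROVER; junction service for row NE7 on ROAD-G116 §6 (G3) ∕ the ℓ² route to (G′)),
generation 163.
WHY.  The curved exact lift of record will be `r_W := r − R₀^W((cpush_W − cpush_1)(r ·))` (row NE3's exact `R₀`); its distance to the flat lift `r` (✓ `exactLift`, composites ✓ (C)) is the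
`ℓ²` size of the defect `(cpush_W − cpush_1)(r w)`.  Road F1 ✓ `NE7PushDirNearFlat.norm_pushDir_sub_Tside_le_box` bounds the defect POINTWISE by `(64β + 1250w + 2R·b)·Q·dirL1(box R)`
with the cube-holonomy radius `w` (curvature: ✓ `norm_Wcx_sub_one_le`), the bond radius `b` and the averaged-bond radius `β ≤ 64(d+1)(d+4)L²a + L·b` (✓ `norm_bavg_sub_straight_le_of_pdev` +
✓ `B9Eq315QLipschitz.norm_hol_sub_one_le`).  THIS FILE sums it over the coarse period box: Cauchy–Schwarz `dirL1² ≤ #box·d·dirSq` (✓ F3) and the box multiplicity on the torus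
(✓ `sum_periodBox_box_le`).
WHAT ([folklore]; DATA defs `defA`, `defB`, `defC` (explicit constants); 0 sorry; every `d`, `L, N ≥ 1`):
`norm_bavg_sub_one_le_of_bonds'` (`β ≤ 64(d+1)(d+4)L²a + L·b`, NO smallness of `b`), `norm_cpush_sub_cpush_flat_le` (pointwise), and the headline **`dirSq_cpush_sub_cpush_flat_le`**:
for `W` unitary, `SmallField W a` with `512(d+1)(d+4)L²a ≤ 1`, `‖W(x,μ) − 1‖ ≤ b` everywhere, and `Y` `(L·N)`-periodic:
`dirSq (fun z κ => cpush L W Y z κ − cpush L 1 Y z κ) (periodBox N) ≤ defC d L·(defA d L·a + defB d L·b)²·dirSq Y (periodBox (L·N))`.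
WHAT IS NOT HERE: the curved exact lift and its composites (files (R4c–d)); any claim that `b` is small (it is a DISPLAYED radius; memo §4).
HONEST FRAMING (page 1): lattice kinematics about OUR linearised averages; nothing of Bałaban's asserted ([Balaban1985Averaging] (42), (47) context only); NOT (G3), NOT (G′), NOT NE7∕NE3 as spine
nodes; row NE7b NOT PRINTED ∕ NOT PROVED; spine 0∕9; finite T⁴ rung (B)+1 — NOT infinite volume, NOT mass gap, NOT BetaPertH, NOT Clay.
-/

set_option autoImplicit false

open scoped BigOperators Matrix Matrix.Norms.L2Operator
open Finset

namespace Summit.QuantumFields.BalabanUV.T4Continuum.NE7CurvedPushDefectLetter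

open Literature.MathematicalPhysics.QuantumFieldTheory.Balaban1983to89
open B7Prop1Explicit B7Prop2Explicit MatrixLog UnitaryModel
open T4AveragingDeficitWall (IsUnitaryCfg SmallField dirL1 dirSq box)
open T4AveragingDeficitWallBoundary (IsPeriodicCfg periodBox)
open AveragingDeficitPeriodicCounting (IsPeriodicDir sum_periodBox_box_le)
open AveragingDeficitCounting (card_box_eq)
open AveragingDeficitTransport (mem_U1_of_unitary)
open AveragingDeficitMultiLevelPrep (cpush)
open AveragingDeficitResidualPairing (pushDir)
open BlockAveragePushDirSplit (flat pushDir_flat)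
open MinimalActionWitness (flatCfg)
open NE3TangentFlatPush (flatCfg_eq_flat)
open NE7PushDirNearFlat (norm_pushDir_sub_Tside_le_box)
open NE7CoarseCurlEnergyCurved (dirL1_sq_le_card_mul_dirSq)
open NE3EnergyHessContTwoTerm (dirSq_nonneg)

noncomputable section

variable {d : ℕ} {n : Type*} [Fintype n] [DecidableEq n]

/-- The `a`-coefficient of the defect: `(64·64 + 1250·16)(d+1)(d+4)L²·Q`, `Q = (2d+2)L + L`. [folklore] -/
def defA (d L : ℕ) : ℝ := (64 * 64 + 1250 * 16) * ((d : ℝ) + 1) * ((d : ℝ) + 4) * (L : ℝ) ^ 2 * ((((2 * d + 2) * L : ℕ) : ℝ) + L)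
/-- The `b`-coefficient of the defect: `(64·L + 2(2d+2)L)·Q`. [folklore] -/
def defB (d L : ℕ) : ℝ := (64 * (L : ℝ) + 2 * (((2 * d + 2) * L : ℕ) : ℝ)) * ((((2 * d + 2) * L : ℕ) : ℝ) + L)
/-- The counting constant `d²·(2R+1)^{2d}`, `R = (2d+2)L`. [folklore] -/
def defC (d L : ℕ) : ℝ := (d : ℝ) ^ 2 * ((2 * ((2 * d + 2) * L) + 1 : ℕ) : ℝ) ^ d * ((2 * ((2 * d + 2) * L) + 1 : ℕ) : ℝ) ^ d

omit [Fintype n] [DecidableEq n] in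
/-- `0 ≤ defA`. [folklore] -/
theorem defA_nonneg (d L : ℕ) : 0 ≤ defA d L := by unfold defA; positivity
omit [Fintype n] [DecidableEq n] in
/-- `0 ≤ defB`. [folklore] -/
theorem defB_nonneg (d L : ℕ) : 0 ≤ defB d L := by unfold defB; positivity
omit [Fintype n] [DecidableEq n] in
/-- `0 ≤ defC`. [folklore] -/
theorem defC_nonneg (d L : ℕ) : 0 ≤ defC d L := by unfold defC; positivity

/-- **THE AVERAGED BOND NEAR 1, WITHOUT SMALLNESS OF THE BOND RADIUS**: `‖Ū(c) − 1‖ ≤ 64(d+1)(d+4)L²·a + L·b` (curvature part ✓ `norm_bavg_sub_straight_le_of_pdev`, straight holonomy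
by telescoping ✓ `norm_hol_sub_one_le`). [folklore] -/
theorem norm_bavg_sub_one_le_of_bonds' [Nonempty n] {L : ℕ} (hL : 1 ≤ L) {W : Site d → Fin d → (Matrix n n ℂ)ˣ} (hW : IsUnitaryCfg W)
    {a : ℝ} (ha : 0 ≤ a) (h512 : 512 * (d + 1) * (d + 4) * (L : ℝ) ^ 2 * a ≤ 1) (hWa : SmallField W a)
    {b : ℝ} (hWb : ∀ (x : Site d) (μ : Fin d), ‖((W x μ : (Matrix n n ℂ)ˣ) : Matrix n n ℂ) - 1‖ ≤ b) (q : Site d) (κ : Fin d) :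
    ‖((bavg L W q κ : (Matrix n n ℂ)ˣ) : Matrix n n ℂ) - 1‖ ≤ 64 * (d + 1) * (d + 4) * (L : ℝ) ^ 2 * a + L * b := by
  have hU1 : ∀ x κ, W x κ ∈ U1 (Matrix n n ℂ) := fun x κ => mem_U1_of_unitary (hW x κ)
  have h1 := B7Eq47AveragedBondVsStraight.norm_bavg_sub_straight_le_of_pdev L hL hU1 ha h512 (fun x κ κ' hne => hWa x κ κ' hne) q κ
  have h2 := B9Eq315QLipschitz.norm_hol_sub_one_le hU1 hWb q (seg κ (L : ℤ))
  rw [length_seg, Int.natAbs_natCast] at h2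
  calc ‖((bavg L W q κ : (Matrix n n ℂ)ˣ) : Matrix n n ℂ) - 1‖
      ≤ ‖((bavg L W q κ : (Matrix n n ℂ)ˣ) : Matrix n n ℂ) - ((hol W q (seg κ (L : ℤ)) : (Matrix n n ℂ)ˣ) : Matrix n n ℂ)‖
        + ‖((hol W q (seg κ (L : ℤ)) : (Matrix n n ℂ)ˣ) : Matrix n n ℂ) - 1‖ := norm_sub_le_norm_sub_add_norm_sub _ _ _
    _ ≤ _ := add_le_add h1 h2

/-- **POINTWISE DEFECT**: `‖cpush L W Y z κ − cpush L 1 Y z κ‖ ≤ (defA·a + defB·b)·dirL1 Y (box ((2d+2)L) (L•z))`. [folklore] -/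
theorem norm_cpush_sub_cpush_flat_le [Nonempty n] {L : ℕ} (hL : 1 ≤ L) {W : Site d → Fin d → (Matrix n n ℂ)ˣ} (hW : IsUnitaryCfg W)
    {a : ℝ} (ha : 0 ≤ a) (h512 : 512 * (d + 1) * (d + 4) * (L : ℝ) ^ 2 * a ≤ 1) (hWa : SmallField W a)
    {b : ℝ} (hb : 0 ≤ b) (hWb : ∀ (x : Site d) (μ : Fin d), ‖((W x μ : (Matrix n n ℂ)ˣ) : Matrix n n ℂ) - 1‖ ≤ b)
    (Y : Site d → Fin d → Matrix n n ℂ) (z : Site d) (κ : Fin d) :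
    ‖cpush L W Y z κ - cpush L (flatCfg (d := d) (n := n)) Y z κ‖ ≤ (defA d L * a + defB d L * b) * dirL1 Y (box ((2 * d + 2) * L) ((L : ℤ) • z)) := by
  have hd : 1 ≤ d := Nat.one_le_iff_ne_zero.mpr (by rintro rfl; exact Fin.elim0 κ)
  have hU1 : ∀ x κ, W x κ ∈ U1 (Matrix n n ℂ) := fun x κ => mem_U1_of_unitary (hW x κ)
  -- cube holonomies from the small field
  set w : ℝ := 2 * (8 * (d + 1) * (d + 4) * (L : ℝ) ^ 2 * a) with hw
  have hloop : ∀ r : Fin d → Fin L, ‖((Wcx L W ((L : ℤ) • z) κ (boxVec L r) : (Matrix n n ℂ)ˣ) : Matrix n n ℂ) - 1‖ ≤ w :=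
    fun r => norm_Wcx_sub_one_le L hL W hU1 ha h512 (fun x κ κ' hne => hWa x κ κ' hne) _ κ r
  have hw32 : w ≤ 1 / 32 := by
    rw [hw]
    have hd0 : (0 : ℝ) ≤ d := Nat.cast_nonneg d
    nlinarith [h512]
  -- averaged bond
  set β : ℝ := 64 * (d + 1) * (d + 4) * (L : ℝ) ^ 2 * a + L * b with hβ
  have hβW := norm_bavg_sub_one_le_of_bonds' hL hW ha h512 hWa hWb ((L : ℤ) • z) κ
  -- F1
  have h := norm_pushDir_sub_Tside_le_box hL hW Y ((L : ℤ) • z) κ hb hw32 hloop (fun x μ _ => hWb x μ) hβW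
  have hT : cpush L (flatCfg (d := d) (n := n)) Y z κ = Tside L Y ((L : ℤ) • z) κ := by
    show pushDir L flatCfg Y ((L : ℤ) • z) κ = _
    rw [flatCfg_eq_flat, pushDir_flat L hL]
  have hP : cpush L W Y z κ = pushDir L W Y ((L : ℤ) • z) κ := rfl
  rw [hT, hP]
  refine h.trans ?_
  have hD := AveragingDeficitDerivCore.dirL1_nonneg Y (box ((2 * d + 2) * L) ((L : ℤ) • z))
  rw [← mul_assoc]
  refine mul_le_mul_of_nonneg_right (le_of_eq ?_) hD
  rw [hw]
  unfold defA defB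
  push_cast
  ring

/-- **THE DEFECT LETTER IN `ℓ²` OVER THE PERIOD BOX** (`L, N ≥ 1`; `W` unitary, small-field of radius `a` with `512(d+1)(d+4)L²a ≤ 1` and bondwise radius `b`; `Y`
`(L·N)`-periodic): `dirSq (cpush L W Y − cpush L 1 Y) [0,N)^d ≤ defC·(defA·a + defB·b)²·dirSq Y [0,LN)^d`. [folklore] -/
theorem dirSq_cpush_sub_cpush_flat_le [Nonempty n] {L N : ℕ} (hL : 1 ≤ L) (hN : 1 ≤ N) {W : Site d → Fin d → (Matrix n n ℂ)ˣ} (hW : IsUnitaryCfg W)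
    {a : ℝ} (ha : 0 ≤ a) (h512 : 512 * (d + 1) * (d + 4) * (L : ℝ) ^ 2 * a ≤ 1) (hWa : SmallField W a)
    {b : ℝ} (hb : 0 ≤ b) (hWb : ∀ (x : Site d) (μ : Fin d), ‖((W x μ : (Matrix n n ℂ)ˣ) : Matrix n n ℂ) - 1‖ ≤ b)
    {Y : Site d → Fin d → Matrix n n ℂ} (hYP : IsPeriodicDir Y ((L : ℤ) * N)) :
    dirSq (fun z κ => cpush L W Y z κ - cpush L (flatCfg (d := d) (n := n)) Y z κ) (periodBox (d := d) N)
      ≤ defC d L * (defA d L * a + defB d L * b) ^ 2 * dirSq Y (periodBox (d := d) (L * N)) := by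
  classical
  set R : ℕ := (2 * d + 2) * L with hR
  set E : ℝ := defA d L * a + defB d L * b with hE
  have hE0 : 0 ≤ E := by rw [hE]; exact add_nonneg (mul_nonneg (defA_nonneg d L) ha) (mul_nonneg (defB_nonneg d L) hb)
  -- pointwise, squared, Cauchy–Schwarz
  have hpt : ∀ (z : Site d) (κ : Fin d), ‖cpush L W Y z κ - cpush L (flatCfg (d := d) (n := n)) Y z κ‖ ^ 2
      ≤ E ^ 2 * ((((box R ((L : ℤ) • z)).card * d : ℕ) : ℝ) * dirSq Y (box R ((L : ℤ) • z))) := by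
    intro z κ
    have h1 := norm_cpush_sub_cpush_flat_le hL hW ha h512 hWa hb hWb Y z κ
    have h2 := dirL1_sq_le_card_mul_dirSq Y (box R ((L : ℤ) • z))
    calc ‖cpush L W Y z κ - cpush L (flatCfg (d := d) (n := n)) Y z κ‖ ^ 2 ≤ (E * dirL1 Y (box R ((L : ℤ) • z))) ^ 2 := pow_le_pow_left₀ (norm_nonneg _) h1 2
      _ = E ^ 2 * dirL1 Y (box R ((L : ℤ) • z)) ^ 2 := by ring
      _ ≤ E ^ 2 * ((((box R ((L : ℤ) • z)).card * d : ℕ) : ℝ) * dirSq Y (box R ((L : ℤ) • z))) := mul_le_mul_of_nonneg_left h2 (sq_nonneg _)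
  -- the box multiplicity on the torus
  set g : Site d → ℝ := fun x => ∑ μ : Fin d, ‖Y x μ‖ ^ 2 with hg
  have hg0 : ∀ x, 0 ≤ g x := fun x => Finset.sum_nonneg fun _ _ => sq_nonneg _
  have hgP : ∀ (x : Site d) (κ : Fin d), g (x + ((L * N : ℕ) : ℤ) • e κ) = g x := by
    intro x κ
    simp only [hg]
    refine Finset.sum_congr rfl fun μ _ => ?_
    rw [show (((L * N : ℕ) : ℤ)) = (L : ℤ) * N by push_cast; ring, hYP x κ μ]
  have hmult := sum_periodBox_box_le L N hL hN R hg0 hgP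
  have hbox : ∀ z : Site d, dirSq Y (box R ((L : ℤ) • z)) = ∑ x ∈ box R ((L : ℤ) • z), g x := fun z => rfl
  calc dirSq (fun z κ => cpush L W Y z κ - cpush L (flatCfg (d := d) (n := n)) Y z κ) (periodBox (d := d) N)
      = ∑ z ∈ periodBox (d := d) N, ∑ κ : Fin d, ‖cpush L W Y z κ - cpush L (flatCfg (d := d) (n := n)) Y z κ‖ ^ 2 := rfl
    _ ≤ ∑ z ∈ periodBox (d := d) N, ∑ _κ : Fin d, E ^ 2 * ((((2 * R + 1) ^ d * d : ℕ) : ℝ) * dirSq Y (box R ((L : ℤ) • z))) := by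
        refine Finset.sum_le_sum fun z _ => Finset.sum_le_sum fun κ _ => (hpt z κ).trans (le_of_eq ?_)
        rw [card_box_eq]
    _ = (d : ℝ) * (E ^ 2 * ((((2 * R + 1) ^ d * d : ℕ) : ℝ))) * ∑ z ∈ periodBox (d := d) N, ∑ x ∈ box R ((L : ℤ) • z), g x := by
        simp only [Finset.sum_const, Finset.card_univ, Fintype.card_fin, nsmul_eq_mul, hbox]
        rw [Finset.mul_sum]
        exact Finset.sum_congr rfl fun z _ => by ring
    _ ≤ (d : ℝ) * (E ^ 2 * ((((2 * R + 1) ^ d * d : ℕ) : ℝ))) * ((2 * R + 1) ^ d * ∑ x ∈ periodBox (d := d) (L * N), g x) :=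
        mul_le_mul_of_nonneg_left hmult (by positivity)
    _ = defC d L * E ^ 2 * dirSq Y (periodBox (d := d) (L * N)) := by
        unfold defC dirSq
        rw [hR]
        push_cast
        ring

end

end Summit.QuantumFields.BalabanUV.T4Continuum.NE7CurvedPushDefectLetter
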